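import Mathlib
import HarnessLib
import Summits.Ventures.LatticeQCDFlow.Scoring.RestartChainJarzynskiDeltaF
import Summits.Ventures.LatticeQCDFlow.Scoring.CPNHeatBathSweepBatchMeans
import Summits.Ventures.LatticeQCDFlow.Scoring.HeatBathSweepAutocorrelation

/-!
# S0-D2 AS RUN, PRODUCTION PRIOR: the composite `cpn_2d` sweep "heat baths, then any exact update"
# (the OR:HB cycle) is a legal PRIOR CHAIN of the correlated-restart Jarzynski protocol — it is
# minorised in one step by the lattice CP(N−1) law itself — so the studentised `ΔF̂ = −log Ḡ` along
# the restart chain it drives is asymptotically standard normal from every start, with exact coverage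

HONEST FRAMING: exact (Metropolis-corrected) sampling algorithms for lattice gauge theory;
figures of merit are autocorrelation/cost numbers at stated couplings and volumes; no
continuum-physics claim.

Venture `LatticeQCDFlow` (cell pub-lqcd), topic `Scoring`; FANOUT row 8 (`s0-cpn-nemc` — the 2D
CP(N−1) NE-MCMC seat; the printed protocol's equilibrium updates are over-relaxation + heat-bath
sweeps, Bonanno–Nada–Vadacchino 2024 NAMED ONLY — GEN-25).  NEW WORK of the cell, not a published
result; no definition is introduced; nothing is cited as a fact.  Companion of
`Scoring/CPNRestartChainJarzynski.lean` (the Metropolis-sweep prior), same argument.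

THE OBJECTS.  Row 9's composite `cpn_2d` sweep `η ∘ₖ cycle (l.map (siteHeatBath (cpnRef V E d)
(gibbsDensity (cpnAction src tgt J c))))` on CP(N−1) configurations — a single-site heat-bath scan
visiting every variable followed by ANY Markov kernel `η` leaving the Gibbs weight
`(⊗ uniform).withDensity e^{−S}` invariant (over-relaxation / microcanonical moves) — exact for
`cpnGibbsLaw src tgt J c` and minorised IN ONE STEP by the probability law `(⊗ uniform).bind η`
(`Scoring/CPNHeatBathSweepBatchMeans.lean`: `cpn_heatBathSweep_comp_minorised`, GEN-19); and GEN-22's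
error bar of the correlated-restart Jarzynski estimator (`Scoring/RestartChainJarzynskiDeltaF.lean`),
whose prior-side hypothesis is a one-step minorisation BY the prior law `π₀` itself.  This file
transports the uniform-law certificate to that form — the uniform law dominates `Z M⁻¹ · cpnGibbsLaw`
(`Scoring/HeatBathSweepAutocorrelation.pi_ge_piGibbsLaw`, `M` the maximum of the continuous Gibbs
density on the compact configuration space), hence so does its push-forward under `η`, by the
invariance of `cpnGibbsLaw` under `η` — and reads off the protocol's error bar:

* **`cpn_heatBathSweep_comp_minorised_by_cpnGibbsLaw`** — `cpnGibbsLaw` is invariant AND there is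
  `ε ∈ (0, 1)` with `ε · cpnGibbsLaw(A) ≤ (η ∘ₖ HB-scan)(ω, A)` for every configuration `ω` and
  measurable `A`;
* **`cpn_heatBathComp_restart_jarzynski_deltaF_studentized_clt`** — for ANY Crooks pair
  `(κF, κR, s, e, W)` on a path space `P` from a finite `ν₀` with `Z₀⁻¹ ν₀ = cpnGibbsLaw src tgt J c`
  (per-link couplings `c` encode the open / defect boundary of the prior ensemble) to a finite `ν₁`,
  work floor, `e^{−ΔF} = Z₁/Z₀`, `σ²_G > 0` (ASSUMED): along the restart chain driven by the composite
  sweep, for `Y ~ N(0, 1)`, any `a_n, b_n → ∞` and EVERY initial law `μ₀`,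
  `√N_n (−log Ḡ_{N_n} − ΔF) / (|−Ḡ⁻¹| √(σ̂²_n)) ⇒ Y`;
* **`cpn_heatBathComp_restart_jarzynski_deltaF_coverage`** — for every `z > 0`,
  `P_{μ₀} {|√N_n (−log Ḡ − ΔF)| / (|−Ḡ⁻¹| √(σ̂²_n)) ≤ z} → (gaussianReal 0 1)[−z, z]`.

NOT CLAIMED: any value of `ε`, `σ²_G` or of the bar for a concrete `(N, β, L, n_step)`; the
construction of the CP(N−1) non-equilibrium evolution as a Crooks pair (a hypothesis, as in every
restart-chain file); `η` ranging beyond kernels that leave the Gibbs weight invariant; the degenerate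
case `σ²_G = 0`; any number of ours.
-/

noncomputable section

namespace Summit.Ventures.LatticeQCDFlow.Scoring

open MeasureTheory ProbabilityTheory Filter Finset Preorder Set
open Summit.Ventures.LatticeQCDFlow.Exactness Summit.Ventures.LatticeQCDFlow.Exactness.GeneralNCMC
open Literature.Probability.MarkovChains
open scoped ENNReal Topology

section CPN

variable {V E : Type*} [Fintype V] [Fintype E] [DecidableEq V] [DecidableEq E] {d : ℕ}
  (src tgt : E → V) (J : EuclideanSpace ℝ (Fin (d + 2)) →L[ℝ] EuclideanSpace ℝ (Fin (d + 2)))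
  (c : E → ℝ)

/-- **THE COMPOSITE `cpn_2d` SWEEP "HEAT BATHS, THEN ANY EXACT UPDATE `η`" IS MINORISED BY THE
LATTICE CP(N−1) LAW ITSELF, IN ONE STEP** (the scan visits every variable; `η` leaves the Gibbs
weight invariant — e.g. row 9's over-relaxation moves): `cpnGibbsLaw` is invariant and there is
`ε ∈ (0, 1)` with `ε · cpnGibbsLaw(A) ≤ (η ∘ₖ HB-scan)(ω, A)` for every `ω` and measurable `A`. -/
theorem cpn_heatBathSweep_comp_minorised_by_cpnGibbsLaw {l : List (V ⊕ E)} (hl : ∀ i, i ∈ l)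
    (η : Kernel (CPNConfig V E d) (CPNConfig V E d)) [IsMarkovKernel η]
    (hη : Kernel.Invariant η
      ((Measure.pi (cpnRef V E d)).withDensity (gibbsDensity (cpnAction src tgt J c)))) :
    Kernel.Invariant (η ∘ₖ cycle (l.map (siteHeatBath (cpnRef V E d) (gibbsDensity (cpnAction src tgt J c)))))
        (cpnGibbsLaw src tgt J c) ∧
    ∃ ε : ℝ≥0∞, 0 < ε ∧ ε < 1 ∧ ∀ (ω : CPNConfig V E d) {A : Set (CPNConfig V E d)},
      MeasurableSet A → ε * cpnGibbsLaw src tgt J c A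
        ≤ (η ∘ₖ cycle (l.map (siteHeatBath (cpnRef V E d) (gibbsDensity (cpnAction src tgt J c))))) ω A := by
  obtain ⟨hinv, ε, hε0, hε1, hdoeb⟩ := cpn_heatBathSweep_comp_minorised src tgt J c hl η hη
  refine ⟨hinv, ?_⟩
  -- `η` leaves the normalised law invariant too
  have hηπ : Kernel.Invariant η (cpnGibbsLaw src tgt J c) := Exactness.invariant_smul hη _
  have hS := continuous_cpnAction src tgt J c (V := V) (E := E) (d := d)
  haveI : ∀ i, Nonempty (CPNVar V E d i) := fun i =>
    nonempty_of_isProbabilityMeasure (cpnRef V E d i)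
  haveI : Nonempty (CPNConfig V E d) := inferInstance
  obtain ⟨ωa, -, hmin⟩ := isCompact_univ.exists_isMinOn Set.univ_nonempty hS.continuousOn
  obtain ⟨ωb, -, hmax⟩ := isCompact_univ.exists_isMaxOn Set.univ_nonempty hS.continuousOn
  have hωa : ∀ ω, cpnAction src tgt J c ωa ≤ cpnAction src tgt J c ω := fun ω =>
    (isMinOn_iff.1 hmin) ω (Set.mem_univ ω)
  have hωb : ∀ ω, cpnAction src tgt J c ω ≤ cpnAction src tgt J c ωb := fun ω =>
    (isMaxOn_iff.1 hmax) ω (Set.mem_univ ω)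
  have hm0 : ENNReal.ofReal (Real.exp (-cpnAction src tgt J c ωb)) ≠ 0 := by
    rw [Ne, ENNReal.ofReal_eq_zero, not_le]; exact Real.exp_pos _
  have hMtop : ENNReal.ofReal (Real.exp (-cpnAction src tgt J c ωa)) ≠ ∞ := ENNReal.ofReal_ne_top
  have hM0 : ENNReal.ofReal (Real.exp (-cpnAction src tgt J c ωa)) ≠ 0 := by
    rw [Ne, ENNReal.ofReal_eq_zero, not_le]; exact Real.exp_pos _
  have hmp : ∀ ω, ENNReal.ofReal (Real.exp (-cpnAction src tgt J c ωb))
      ≤ gibbsDensity (cpnAction src tgt J c) ω := fun ω =>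
    ENNReal.ofReal_le_ofReal (Real.exp_le_exp.2 (neg_le_neg (hωb ω)))
  have hpM : ∀ ω, gibbsDensity (cpnAction src tgt J c) ω
      ≤ ENNReal.ofReal (Real.exp (-cpnAction src tgt J c ωa)) := fun ω =>
    ENNReal.ofReal_le_ofReal (Real.exp_le_exp.2 (neg_le_neg (hωa ω)))
  have hZlow : ENNReal.ofReal (Real.exp (-cpnAction src tgt J c ωb))
      ≤ ∫⁻ ω, gibbsDensity (cpnAction src tgt J c) ω ∂Measure.pi (cpnRef V E d) := by
    calc ENNReal.ofReal (Real.exp (-cpnAction src tgt J c ωb))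
        = ∫⁻ _, ENNReal.ofReal (Real.exp (-cpnAction src tgt J c ωb)) ∂Measure.pi (cpnRef V E d) := by
          rw [lintegral_const, measure_univ, mul_one]
      _ ≤ _ := lintegral_mono fun ω => hmp ω
  have hZup : ∫⁻ ω, gibbsDensity (cpnAction src tgt J c) ω ∂Measure.pi (cpnRef V E d)
      ≤ ENNReal.ofReal (Real.exp (-cpnAction src tgt J c ωa)) := by
    calc ∫⁻ ω, gibbsDensity (cpnAction src tgt J c) ω ∂Measure.pi (cpnRef V E d)
        ≤ ∫⁻ _, ENNReal.ofReal (Real.exp (-cpnAction src tgt J c ωa)) ∂Measure.pi (cpnRef V E d) :=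
          lintegral_mono fun ω => hpM ω
      _ = _ := by rw [lintegral_const, measure_univ, mul_one]
  have hq1 : (∫⁻ ω, gibbsDensity (cpnAction src tgt J c) ω ∂Measure.pi (cpnRef V E d))
      * (ENNReal.ofReal (Real.exp (-cpnAction src tgt J c ωa)))⁻¹ ≤ 1 := by
    calc (∫⁻ ω, gibbsDensity (cpnAction src tgt J c) ω ∂Measure.pi (cpnRef V E d))
          * (ENNReal.ofReal (Real.exp (-cpnAction src tgt J c ωa)))⁻¹
        ≤ ENNReal.ofReal (Real.exp (-cpnAction src tgt J c ωa))
          * (ENNReal.ofReal (Real.exp (-cpnAction src tgt J c ωa)))⁻¹ := mul_le_mul' hZup le_rfl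
      _ = 1 := ENNReal.mul_inv_cancel hM0 hMtop
  have hq0 : (∫⁻ ω, gibbsDensity (cpnAction src tgt J c) ω ∂Measure.pi (cpnRef V E d))
      * (ENNReal.ofReal (Real.exp (-cpnAction src tgt J c ωa)))⁻¹ ≠ 0 :=
    mul_ne_zero (lt_of_lt_of_le (pos_iff_ne_zero.2 hm0) hZlow).ne' (ENNReal.inv_ne_zero.2 hMtop)
  -- the uniform law dominates `Z M⁻¹ · cpnGibbsLaw` as a measure
  have hle : ((∫⁻ ω, gibbsDensity (cpnAction src tgt J c) ω ∂Measure.pi (cpnRef V E d))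
      * (ENNReal.ofReal (Real.exp (-cpnAction src tgt J c ωa)))⁻¹) • cpnGibbsLaw src tgt J c
        ≤ Measure.pi (cpnRef V E d) := by
    refine Measure.le_iff.2 fun B hB => ?_
    rw [Measure.smul_apply, smul_eq_mul]
    exact pi_ge_piGibbsLaw (μ := cpnRef V E d) (p := gibbsDensity (cpnAction src tgt J c)) hm0 hMtop
      hmp hpM hB
  -- hence its push-forward under `η` dominates `Z M⁻¹ · cpnGibbsLaw` (invariance of `cpnGibbsLaw`)
  have hbind : ∀ {A : Set (CPNConfig V E d)}, MeasurableSet A →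
      (∫⁻ ω, gibbsDensity (cpnAction src tgt J c) ω ∂Measure.pi (cpnRef V E d))
        * (ENNReal.ofReal (Real.exp (-cpnAction src tgt J c ωa)))⁻¹ * cpnGibbsLaw src tgt J c A
          ≤ ((Measure.pi (cpnRef V E d)).bind η) A := fun {A} hA => by
    rw [Measure.bind_apply hA (Kernel.aemeasurable _)]
    calc (∫⁻ ω, gibbsDensity (cpnAction src tgt J c) ω ∂Measure.pi (cpnRef V E d))
          * (ENNReal.ofReal (Real.exp (-cpnAction src tgt J c ωa)))⁻¹ * cpnGibbsLaw src tgt J c A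
        = (∫⁻ ω, gibbsDensity (cpnAction src tgt J c) ω ∂Measure.pi (cpnRef V E d))
          * (ENNReal.ofReal (Real.exp (-cpnAction src tgt J c ωa)))⁻¹
          * ((cpnGibbsLaw src tgt J c).bind η) A := by rw [hηπ.def]
      _ = (∫⁻ ω, gibbsDensity (cpnAction src tgt J c) ω ∂Measure.pi (cpnRef V E d))
          * (ENNReal.ofReal (Real.exp (-cpnAction src tgt J c ωa)))⁻¹
          * ∫⁻ x, η x A ∂(cpnGibbsLaw src tgt J c) := by
            rw [Measure.bind_apply hA (Kernel.aemeasurable _)]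
      _ = ∫⁻ x, η x A ∂(((∫⁻ ω, gibbsDensity (cpnAction src tgt J c) ω ∂Measure.pi (cpnRef V E d))
          * (ENNReal.ofReal (Real.exp (-cpnAction src tgt J c ωa)))⁻¹) • cpnGibbsLaw src tgt J c) := by
            rw [lintegral_smul_measure, smul_eq_mul]
      _ ≤ ∫⁻ x, η x A ∂Measure.pi (cpnRef V E d) := lintegral_mono' hle le_rfl
  refine ⟨ε * ((∫⁻ ω, gibbsDensity (cpnAction src tgt J c) ω ∂Measure.pi (cpnRef V E d))
      * (ENNReal.ofReal (Real.exp (-cpnAction src tgt J c ωa)))⁻¹),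
    pos_iff_ne_zero.2 (mul_ne_zero hε0.ne' hq0),
    lt_of_le_of_lt (mul_le_of_le_one_right hε0.le hq1) hε1, fun ω A hA => ?_⟩
  calc ε * ((∫⁻ ω, gibbsDensity (cpnAction src tgt J c) ω ∂Measure.pi (cpnRef V E d))
        * (ENNReal.ofReal (Real.exp (-cpnAction src tgt J c ωa)))⁻¹) * cpnGibbsLaw src tgt J c A
      = ε * ((∫⁻ ω, gibbsDensity (cpnAction src tgt J c) ω ∂Measure.pi (cpnRef V E d))
          * (ENNReal.ofReal (Real.exp (-cpnAction src tgt J c ωa)))⁻¹ * cpnGibbsLaw src tgt J c A) := by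
        rw [mul_assoc]
    _ ≤ ε * ((Measure.pi (cpnRef V E d)).bind η) A := mul_le_mul' le_rfl (hbind hA)
    _ ≤ (η ∘ₖ cycle (l.map (siteHeatBath (cpnRef V E d) (gibbsDensity (cpnAction src tgt J c))))) ω A :=
        hdoeb ω hA

variable {P : Type*} [MeasurableSpace P]
  {ν₀ ν₁ : Measure (CPNConfig V E d)} {κF κR : Kernel (CPNConfig V E d) P}
  [IsMarkovKernel κF] [IsMarkovKernel κR] {s e : P → CPNConfig V E d} {W : P → ℝ}

/-- **THE S0-D2 ERROR BAR WITH THE COMPOSITE `cpn_2d` PRIOR, FROM ANY START.**  The scan visits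
every variable, `η` leaves the Gibbs weight invariant; a Crooks pair `(κF, κR, s, e, W)` from `ν₀`
(with `Z₀⁻¹ ν₀ = cpnGibbsLaw`) to `ν₁`,
work floor `W ≥ W_lo`, `e^{−ΔF} = Z₁/Z₀`, `σ²_G > 0`, `a_n, b_n → ∞`, `N_n = b_n a_n`; for
`Y ~ N(0, 1)` and EVERY initial law `μ₀` of the restart chain driven by the composite `cpn_2d`
sweep: `√N_n (−log Ḡ_{N_n} − ΔF) / (|−Ḡ⁻¹| √(σ̂²_n)) ⇒ Y`. -/
theorem cpn_heatBathComp_restart_jarzynski_deltaF_studentized_clt {l : List (V ⊕ E)} (hl : ∀ i, i ∈ l)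
    (η : Kernel (CPNConfig V E d) (CPNConfig V E d)) [IsMarkovKernel η]
    (hη : Kernel.Invariant η
      ((Measure.pi (cpnRef V E d)).withDensity (gibbsDensity (cpnAction src tgt J c))))
    (h : CrooksPair ν₀ ν₁ κF κR s e W)
    (hπ₀ : cpnGibbsLaw src tgt J c = (ν₀ univ)⁻¹ • ν₀)
    {Wlo : ℝ} (hlo : ∀ ω, Wlo ≤ W ω)
    {ΔF : ℝ} (hΔF : Real.exp (-ΔF) = ((ν₀ univ)⁻¹ * ν₁ univ).toReal)
    (hσ : 0 < ((∫ p, (Real.exp (-W p.2) - ∫ p', Real.exp (-W p'.2)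
            ∂(cpnGibbsLaw src tgt J c ⊗ₘ κF)) ^ 2 ∂(cpnGibbsLaw src tgt J c ⊗ₘ κF))
          + 2 * ∑' k, ∫ p, (Real.exp (-W p.2) - ∫ p', Real.exp (-W p'.2)
            ∂(cpnGibbsLaw src tgt J c ⊗ₘ κF))
            * (kop ((Kernel.prodMkRight P
              (η ∘ₖ cycle (l.map (siteHeatBath (cpnRef V E d) (gibbsDensity (cpnAction src tgt J c))))))
                ⊗ₖ (Kernel.prodMkLeft (CPNConfig V E d × P) κF)))^[k + 1]
              (fun p => Real.exp (-W p.2) - ∫ p', Real.exp (-W p'.2)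
                ∂(cpnGibbsLaw src tgt J c ⊗ₘ κF)) p ∂(cpnGibbsLaw src tgt J c ⊗ₘ κF)))
    (μ₀ : Measure (CPNConfig V E d × P)) [IsProbabilityMeasure μ₀] {a b : ℕ → ℕ}
    (ha : Tendsto a atTop atTop) (hb : Tendsto b atTop atTop)
    {Ω' : Type*} [MeasurableSpace Ω'] {P' : Measure Ω'} [IsProbabilityMeasure P'] {Y : Ω' → ℝ}
    (hY : HasLaw Y (gaussianReal 0 1) P')
    [hK : IsMarkovKernel
      (cycle (l.map (siteHeatBath (cpnRef V E d) (gibbsDensity (cpnAction src tgt J c)))))]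
    [IsProbabilityMeasure (Kernel.trajMeasure (X := fun _ : ℕ => CPNConfig V E d × P) μ₀
          (fun n : ℕ => ((Kernel.prodMkRight P
              (η ∘ₖ cycle (l.map (siteHeatBath (cpnRef V E d) (gibbsDensity (cpnAction src tgt J c))))))
              ⊗ₖ (Kernel.prodMkLeft (CPNConfig V E d × P) κF)).comap
            (fun h : (i : ↥(Finset.Iic n)) → CPNConfig V E d × P => h ⟨n, Finset.mem_Iic.2 le_rfl⟩)
            (measurable_pi_apply _)))] :
    TendstoInDistribution (fun (n : ℕ) (x : ℕ → CPNConfig V E d × P) =>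
        Real.sqrt ((b n * a n : ℕ) : ℝ)
          * (-Real.log ((∑ t ∈ Finset.range (b n * a n), Real.exp (-W (x t).2))
            / ((b n * a n : ℕ) : ℝ)) - ΔF)
          / (|(-((∑ t ∈ Finset.range (b n * a n), Real.exp (-W (x t).2)) / ((b n * a n : ℕ) : ℝ))⁻¹)|
            * Real.sqrt (((b n * a n : ℕ) : ℝ) * replicaSEsq (fun j (x : ℕ → CPNConfig V E d × P) =>
              (∑ i ∈ Finset.range (b n), Real.exp (-W (x (b n * j + i)).2)) / (b n)) (a n) x)))
      atTop Y (fun _ => (Kernel.trajMeasure (X := fun _ : ℕ => CPNConfig V E d × P) μ₀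
          (fun n : ℕ => ((Kernel.prodMkRight P
              (η ∘ₖ cycle (l.map (siteHeatBath (cpnRef V E d) (gibbsDensity (cpnAction src tgt J c))))))
              ⊗ₖ (Kernel.prodMkLeft (CPNConfig V E d × P) κF)).comap
            (fun h : (i : ↥(Finset.Iic n)) → CPNConfig V E d × P => h ⟨n, Finset.mem_Iic.2 le_rfl⟩)
            (measurable_pi_apply _)))) P' := by
  haveI := isProbabilityMeasure_cpnGibbsLaw src tgt J c (V := V) (E := E) (d := d)
  obtain ⟨hinv, ε, hε0, -, hdoeb⟩ :=
    cpn_heatBathSweep_comp_minorised_by_cpnGibbsLaw src tgt J c hl η hη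
  exact restart_jarzynski_deltaF_studentized_clt (π₀ := cpnGibbsLaw src tgt J c)
    (κ₀ := η ∘ₖ cycle (l.map (siteHeatBath (cpnRef V E d) (gibbsDensity (cpnAction src tgt J c))))) h hπ₀
    hinv (fun x _ hB => hdoeb x hB) hε0 hlo
    hΔF hσ μ₀ ha hb hY

/-- **ASYMPTOTICALLY EXACT COVERAGE OF THE S0-D2 INTERVAL WITH THE COMPOSITE `cpn_2d` PRIOR.**  Under the
hypotheses of `cpn_heatBathComp_restart_jarzynski_deltaF_studentized_clt`, for every `z > 0`:
`P_{μ₀} {|√N_n (−log Ḡ − ΔF)| / (|−Ḡ⁻¹| √(σ̂²_n)) ≤ z} → (gaussianReal 0 1)[−z, z]`. -/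
theorem cpn_heatBathComp_restart_jarzynski_deltaF_coverage {l : List (V ⊕ E)} (hl : ∀ i, i ∈ l)
    (η : Kernel (CPNConfig V E d) (CPNConfig V E d)) [IsMarkovKernel η]
    (hη : Kernel.Invariant η
      ((Measure.pi (cpnRef V E d)).withDensity (gibbsDensity (cpnAction src tgt J c))))
    (h : CrooksPair ν₀ ν₁ κF κR s e W)
    (hπ₀ : cpnGibbsLaw src tgt J c = (ν₀ univ)⁻¹ • ν₀)
    {Wlo : ℝ} (hlo : ∀ ω, Wlo ≤ W ω)
    {ΔF : ℝ} (hΔF : Real.exp (-ΔF) = ((ν₀ univ)⁻¹ * ν₁ univ).toReal)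
    (hσ : 0 < ((∫ p, (Real.exp (-W p.2) - ∫ p', Real.exp (-W p'.2)
            ∂(cpnGibbsLaw src tgt J c ⊗ₘ κF)) ^ 2 ∂(cpnGibbsLaw src tgt J c ⊗ₘ κF))
          + 2 * ∑' k, ∫ p, (Real.exp (-W p.2) - ∫ p', Real.exp (-W p'.2)
            ∂(cpnGibbsLaw src tgt J c ⊗ₘ κF))
            * (kop ((Kernel.prodMkRight P
              (η ∘ₖ cycle (l.map (siteHeatBath (cpnRef V E d) (gibbsDensity (cpnAction src tgt J c))))))
                ⊗ₖ (Kernel.prodMkLeft (CPNConfig V E d × P) κF)))^[k + 1]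
              (fun p => Real.exp (-W p.2) - ∫ p', Real.exp (-W p'.2)
                ∂(cpnGibbsLaw src tgt J c ⊗ₘ κF)) p ∂(cpnGibbsLaw src tgt J c ⊗ₘ κF)))
    (μ₀ : Measure (CPNConfig V E d × P)) [IsProbabilityMeasure μ₀] {a b : ℕ → ℕ}
    (ha : Tendsto a atTop atTop) (hb : Tendsto b atTop atTop) {z : ℝ} (hz : 0 < z)
    [hK : IsMarkovKernel
      (cycle (l.map (siteHeatBath (cpnRef V E d) (gibbsDensity (cpnAction src tgt J c)))))]
    [IsProbabilityMeasure (Kernel.trajMeasure (X := fun _ : ℕ => CPNConfig V E d × P) μ₀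
          (fun n : ℕ => ((Kernel.prodMkRight P
              (η ∘ₖ cycle (l.map (siteHeatBath (cpnRef V E d) (gibbsDensity (cpnAction src tgt J c))))))
              ⊗ₖ (Kernel.prodMkLeft (CPNConfig V E d × P) κF)).comap
            (fun h : (i : ↥(Finset.Iic n)) → CPNConfig V E d × P => h ⟨n, Finset.mem_Iic.2 le_rfl⟩)
            (measurable_pi_apply _)))] :
    Tendsto (fun n : ℕ => (Kernel.trajMeasure (X := fun _ : ℕ => CPNConfig V E d × P) μ₀
          (fun n : ℕ => ((Kernel.prodMkRight P
              (η ∘ₖ cycle (l.map (siteHeatBath (cpnRef V E d) (gibbsDensity (cpnAction src tgt J c))))))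
              ⊗ₖ (Kernel.prodMkLeft (CPNConfig V E d × P) κF)).comap
            (fun h : (i : ↥(Finset.Iic n)) → CPNConfig V E d × P => h ⟨n, Finset.mem_Iic.2 le_rfl⟩)
            (measurable_pi_apply _))).real
      {x | |Real.sqrt ((b n * a n : ℕ) : ℝ)
          * (-Real.log ((∑ t ∈ Finset.range (b n * a n), Real.exp (-W (x t).2))
            / ((b n * a n : ℕ) : ℝ)) - ΔF)
          / (|(-((∑ t ∈ Finset.range (b n * a n), Real.exp (-W (x t).2)) / ((b n * a n : ℕ) : ℝ))⁻¹)|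
            * Real.sqrt (((b n * a n : ℕ) : ℝ) * replicaSEsq (fun j (x : ℕ → CPNConfig V E d × P) =>
              (∑ i ∈ Finset.range (b n), Real.exp (-W (x (b n * j + i)).2)) / (b n)) (a n) x))| ≤ z})
      atTop (𝓝 ((gaussianReal 0 1).real (Set.Icc (-z) z))) := by
  haveI := isProbabilityMeasure_cpnGibbsLaw src tgt J c (V := V) (E := E) (d := d)
  obtain ⟨hinv, ε, hε0, -, hdoeb⟩ :=
    cpn_heatBathSweep_comp_minorised_by_cpnGibbsLaw src tgt J c hl η hη
  exact restart_jarzynski_deltaF_coverage (π₀ := cpnGibbsLaw src tgt J c)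
    (κ₀ := η ∘ₖ cycle (l.map (siteHeatBath (cpnRef V E d) (gibbsDensity (cpnAction src tgt J c))))) h hπ₀
    hinv (fun x _ hB => hdoeb x hB) hε0 hlo
    hΔF hσ μ₀ ha hb hz

end CPN

end Summit.Ventures.LatticeQCDFlow.Scoring

end
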